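import Mathlib
import Summits.ResolutionOfSingularities.ResolutionOfSingularities.Theorems.HomologicalConductorPersistenceLostCertificate
import Summits.ResolutionOfSingularities.ResolutionOfSingularities.Theorems.HomologicalConductorPersistenceJacobianKept
import Summits.ResolutionOfSingularities.ResolutionOfSingularities.Theorems.HomologicalConductorPersistenceKC3UpperLocal
import Literature.AlgebraicGeometry.Resolution.OriginLocalRing
import Literature.RingTheory.CohomologyAnnihilator.Localization
import HarnessLib

/-!
# Kill test `SurfaceTermination` (stmt-ResolutionOfSingularities-16488), (R-QH) «CUBIC CONE EXIT», part 1: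
# `(∂f) ⊆ ca³ ⊆ ca ⊆ 𝔪²` for the local cubic cone `k[x,y,z]_𝔪 ⧸ (x²y + y²z + z²x)`, every field `k`

Route `ResolutionOfSingularities/HomologicalConductor` (cell `res-hironaka`, chain W4.4), kill test `SurfaceTermination`
(stmt-16488), residue stub `stub_initialPairOfConstantGenus` ((E)-form, registry r8 c2da4ae6bde8d476); res-L0-w44-plan-1
CHAIN v21 (ρ35e) standing offer **(R-QH)** («QH rung of the residue … simple-elliptic cone ↦ exit»), res-D-pv-045 g7.
OURS; AI-written, weaker than expert review; nothing here is a statement of the manuscript under review (Hironaka 2017)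
and no statement of it is used; no theorem here concludes the kill test or the crux.

THE CONE `f = x²y + y²z + z²x` (`x, y, z = X 0, X 1, X 2`): for `char k ≠ 3` the cubic `f = 0` is smooth (`j = 0`) and
`k[x,y,z] ⧸ (f)` is the simple-elliptic germ `Ẽ₆` of degree `3`; the coordinate points `(1:0:0), (0:1:0), (0:0:1)` lie on
it over EVERY field and are NOT collinear (why not Fermat: the universal flexes of `x³+y³+z³` are collinear on
`x+y+z = 0`). Nothing below uses smoothness. At the local model `S_Q ⧸ (f)`, `S_Q = k[x,y,z]_Q`, `hQ : Q = originIdeal k 3`: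
* §1 KOSZUL factorisation `Φ = [[b, q₁],[−a, q₂]]`, `Ψ = [[q₂, −q₁],[a, b]]` of `a q₁ + b q₂` (any commutative ring);
* §2 RULING TEST `map_mem_of_koszul_certificate`: `τ a = τ q₂ = 0`, `τ b, τ q₁ ∈ I`, `c·1 = G Ψ + Φ E` ⇒ `τ c ∈ I`;
* §3 test maps `k[x,y,z]_𝔪 → k⟦T⟧` (polynomial ↔ power-series membership in `(Tⁿ)`: res-type-010's `KC3Upper.coe_mem_span_X_pow_iff`) and the LOCAL ENGINE `mk_algebraMap_not_mem_cohomologyAnnihilatorOfDegree_of_test`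
  (res-D-pv-026's LOST criterion `LostCertificate.not_mem_cohomologyAnnihilatorOfDegree_of_not_exists_certificate`, p521040);
* §4 the three RULINGS `f = y(x² + yz) + z(zx) = z(y² + zx) + x(xy) = x(z² + xy) + y(yz)` tested along `(T,0,0)`, `(0,T,0)`,
  `(0,0,T)`: CEILING **`mem_sq_of_mk_algebraMap_mem_cohomologyAnnihilatorOfDegree`** — `c̄ ∈ caⁿ(S_Q ⧸ (f)) ⇒ c ∈ 𝔪²`;
* §5 FLOOR `mk_algebraMap_pderiv_mem_cohomologyAnnihilatorOfDegree_three`: `(∂f/∂Xᵢ)‾ ∈ ca³(S_Q ⧸ (f))` (res-D-pv-058's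
  `PersistenceJacobianKept.pderiv_mem_cohomologyAnnihilatorOfDegree`, p522421, + [cite: IyengarTakahashi2014, Lemma 2.10 (1)]);
  so `x² + 2yz, y² + 2zx, z² + 2xy ∈ ca³`.
Part 2 (`…CubicConeExit`) transports this to the route's `T₀ = loc O A ⊆ K` and derives the (E) pair and the exit.
References (mechanism only): S. B. Iyengar, R. Takahashi, IMRN 2016 §2 [`IyengarTakahashi2014`]; res-L0-w44-lead-1
`K44S-NONRATIONAL.md` §4 (4a)/(4b) (OURS, paper: plane-curve / elliptic cones exit at step 1).
-/

noncomputable section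
noncomputable section

-- single-problem summit: the doubled namespace component `ResolutionOfSingularities` is forced
set_option linter.dupNamespace false

namespace Summit.ResolutionOfSingularities.ResolutionOfSingularities.Theorems.SurfaceTermination.CubicCone

open MvPolynomial
open Literature.RingTheory.CohomologyAnnihilator
open Literature.AlgebraicGeometry.Resolution
open Summit.ResolutionOfSingularities.ResolutionOfSingularities.Theorems.HomologicalConductor

universe u v

/-! ## §1 The Koszul matrix factorisation of `a q₁ + b q₂` -/

section Koszul

variable {B : Type u} [CommRing B]

/-- **`Φ Ψ = (a q₁ + b q₂)·1`** for `Φ = [[b, q₁],[−a, q₂]]`, `Ψ = [[q₂, −q₁],[a, b]]`, over any commutative ring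
(the rank-two Koszul / ruling factorisation of a two-term hypersurface equation). [folklore] -/
theorem koszulMF_mul (a b q₁ q₂ : B) :
    !![b, q₁; -a, q₂] * !![q₂, -q₁; a, b] = (a * q₁ + b * q₂) • (1 : Matrix (Fin 2) (Fin 2) B) := by
  ext i j
  fin_cases i <;> fin_cases j <;> simp [Matrix.mul_apply, Fin.sum_univ_two, Matrix.smul_apply] <;> ring

/-- **`Ψ Φ = (a q₁ + b q₂)·1`** (second order). [folklore] -/
theorem koszulMF_mul' (a b q₁ q₂ : B) :
    !![q₂, -q₁; a, b] * !![b, q₁; -a, q₂] = (a * q₁ + b * q₂) • (1 : Matrix (Fin 2) (Fin 2) B) := by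
  ext i j
  fin_cases i <;> fin_cases j <;> simp [Matrix.mul_apply, Fin.sum_univ_two, Matrix.smul_apply] <;> ring

/-- `det [[b, q₁],[−a, q₂]] = a q₁ + b q₂`. [folklore] -/
theorem koszulMF_det (a b q₁ q₂ : B) : (!![b, q₁; -a, q₂] : Matrix (Fin 2) (Fin 2) B).det = a * q₁ + b * q₂ := by
  rw [Matrix.det_fin_two_of]
  ring

/-! ## §2 The ruling test: a certificate for `c` forces `τ c ∈ I` -/

variable {D : Type v} [CommRing D]

/-- **THE RULING TEST.** `τ : B → D` a ring map, `I ⊆ D` an ideal with `τ a = τ q₂ = 0` and `τ b, τ q₁ ∈ I`; a certificate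
`c·1 = G Ψ + Φ E` over the Koszul factorisation forces **`τ c ∈ I`** (apply `τ`, read entry `(0,0)`: column `0` of `τ Ψ`
vanishes, row `0` of `τ Φ` lies in `I`; geometrically `τ` restricts to the ruling `a = q₂ = 0`). [folklore] -/
theorem map_mem_of_koszul_certificate (τ : B →+* D) (I : Ideal D) {a b q₁ q₂ c : B} (ha : τ a = 0)
    (hq₂ : τ q₂ = 0) (hb : τ b ∈ I) (hq₁ : τ q₁ ∈ I) {G E : Matrix (Fin 2) (Fin 2) B}
    (hcert : c • (1 : Matrix (Fin 2) (Fin 2) B) = G * !![q₂, -q₁; a, b] + !![b, q₁; -a, q₂] * E) :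
    τ c ∈ I := by
  have h00 := congrArg (fun M : Matrix (Fin 2) (Fin 2) B => τ (M 0 0)) hcert
  simp only [Matrix.smul_apply, Matrix.one_apply_eq, smul_eq_mul, mul_one, Matrix.add_apply, Matrix.mul_apply,
    Fin.sum_univ_two, map_add, map_mul, Matrix.of_apply, Matrix.cons_val', Matrix.cons_val_zero,
    Matrix.cons_val_one, Matrix.cons_val_fin_one, Matrix.empty_val', ha, hq₂, mul_zero, add_zero, zero_add] at h00
  rw [h00]
  exact I.add_mem (I.mul_mem_right _ hb) (I.mul_mem_right _ hq₁)

end Koszul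

/-! ## §3 Test maps `k[x,y,z]_𝔪 → k⟦T⟧` and the local engine -/

section Local

variable (k : Type u) [Field k]

/-- If every `w i` has zero constant coefficient then `(c(w)).coeff 0 = c(0)`. [folklore] -/
theorem coeff_zero_aeval_eq_constantCoeff {n : ℕ} (w : Fin n → Polynomial k) (hw : ∀ i, (w i).coeff 0 = 0)
    (c : MvPolynomial (Fin n) k) : (MvPolynomial.aeval w c).coeff 0 = constantCoeff c := by
  induction c using MvPolynomial.induction_on with
  | C a => simp
  | add p q hp hq => simp [hp, hq]
  | mul_X p i hp =>
    rw [map_mul, Polynomial.mul_coeff_zero, MvPolynomial.aeval_X, hw i, mul_zero, map_mul, constantCoeff_X,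
      mul_zero]

/-- A test map `w : Fin n → k[T]` with `w i (0) = 0` sends polynomials with non-zero constant term to units of
`k⟦T⟧`. [folklore] -/
theorem isUnit_coe_aeval_of_mem_primeCompl {n : ℕ} (w : Fin n → Polynomial k) (hw : ∀ i, (w i).coeff 0 = 0)
    (s : (originIdeal k n).primeCompl) :
    IsUnit (((Polynomial.coeToPowerSeries.ringHom : Polynomial k →+* PowerSeries k).comp
      (MvPolynomial.aeval (R := k) w).toRingHom) (s : MvPolynomial (Fin n) k)) := by
  rw [PowerSeries.isUnit_iff_constantCoeff]
  have hs : constantCoeff (s : MvPolynomial (Fin n) k) ≠ 0 := by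
    have h := s.2
    rw [Ideal.mem_primeCompl_iff, mem_originIdeal_iff] at h
    exact h
  have hc : PowerSeries.constantCoeff
      (((Polynomial.coeToPowerSeries.ringHom : Polynomial k →+* PowerSeries k).comp
        (MvPolynomial.aeval (R := k) w).toRingHom) (s : MvPolynomial (Fin n) k)) =
      constantCoeff (s : MvPolynomial (Fin n) k) := by
    rw [RingHom.comp_apply, Polynomial.coeToPowerSeries.ringHom_apply, ← PowerSeries.coeff_zero_eq_constantCoeff_apply,
      Polynomial.coeff_coe, AlgHom.toRingHom_eq_coe, RingHom.coe_coe, coeff_zero_aeval_eq_constantCoeff k w hw]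
  rw [hc]
  exact isUnit_iff_ne_zero.mpr hs

/-- `f = x²y + y²z + z²x ≠ 0` (evaluate at `(1,1,0)`). [folklore] -/
theorem f_ne_zero : (X 0 ^ 2 * X 1 + X 1 ^ 2 * X 2 + X 2 ^ 2 * X 0 : MvPolynomial (Fin 3) k) ≠ 0 := by
  intro h
  have h1 := congrArg (MvPolynomial.eval (![1, 1, 0] : Fin 3 → k)) h
  simp at h1

/-- **THE LOCAL ENGINE (OURS · W4.4 (R-QH)).** `Q = originIdeal k 3`, `S_Q = k[x,y,z]_Q`, `f = x²y + y²z + z²x = a q₁ + b q₂`,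
a test vector `w : Fin 3 → k[T]` with `w i (0) = 0`, `a(w) = q₂(w) = 0`, `b(w), q₁(w) ∈ (T²)`: every polynomial `c` with
`c(w) ∉ (T²)` has its class OUTSIDE `caᵐ(S_Q ⧸ (f))` for every `m` (Koszul factorisation pushed to `S_Q`, ruling test through
`τ_w : S_Q → k⟦T⟧`, res-D-pv-026's LOST criterion). [OURS · W4.4 kill test] -/
theorem mk_algebraMap_not_mem_cohomologyAnnihilatorOfDegree_of_test (Q : Ideal (MvPolynomial (Fin 3) k)) [Q.IsPrime]
    (hQ : Q = originIdeal k 3) {a b q₁ q₂ : MvPolynomial (Fin 3) k}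
    (hf : a * q₁ + b * q₂ = X 0 ^ 2 * X 1 + X 1 ^ 2 * X 2 + X 2 ^ 2 * X 0)
    (w : Fin 3 → Polynomial k) (hw : ∀ i, (w i).coeff 0 = 0)
    (ha : MvPolynomial.aeval w a = 0) (hq₂ : MvPolynomial.aeval w q₂ = 0)
    (hb : MvPolynomial.aeval w b ∈ Ideal.span ({Polynomial.X ^ 2} : Set (Polynomial k)))
    (hq₁ : MvPolynomial.aeval w q₁ ∈ Ideal.span ({Polynomial.X ^ 2} : Set (Polynomial k)))
    (c : MvPolynomial (Fin 3) k) (hc : MvPolynomial.aeval w c ∉ Ideal.span ({Polynomial.X ^ 2} : Set (Polynomial k)))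
    (m : ℕ) :
    Ideal.Quotient.mk (Ideal.span {algebraMap (MvPolynomial (Fin 3) k) (Localization.AtPrime Q)
        (X 0 ^ 2 * X 1 + X 1 ^ 2 * X 2 + X 2 ^ 2 * X 0)})
      (algebraMap (MvPolynomial (Fin 3) k) (Localization.AtPrime Q) c) ∉
      cohomologyAnnihilatorOfDegree (Localization.AtPrime Q ⧸
        Ideal.span {algebraMap (MvPolynomial (Fin 3) k) (Localization.AtPrime Q)
          (X 0 ^ 2 * X 1 + X 1 ^ 2 * X 2 + X 2 ^ 2 * X 0)}) m := by
  subst hQ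
  set S := Localization.AtPrime (originIdeal k 3)
  set ι : MvPolynomial (Fin 3) k →+* S := algebraMap (MvPolynomial (Fin 3) k) S with hι
  -- the test map
  set τ₁ : MvPolynomial (Fin 3) k →+* PowerSeries k :=
    (Polynomial.coeToPowerSeries.ringHom : Polynomial k →+* PowerSeries k).comp
      (MvPolynomial.aeval (R := k) w).toRingHom with hτ₁
  let τ : S →+* PowerSeries k :=
    IsLocalization.lift (M := (originIdeal k 3).primeCompl) (g := τ₁) (isUnit_coe_aeval_of_mem_primeCompl k w hw)
  have hτ : ∀ p : MvPolynomial (Fin 3) k, τ (ι p) = ((MvPolynomial.aeval w p : Polynomial k) : PowerSeries k) := by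
    intro p
    rw [hι, IsLocalization.lift_eq]
    rfl
  -- `f ∈ S⁰`, noetherian
  have hinj : Function.Injective ι := IsLocalization.injective S (originIdeal k 3).primeCompl_le_nonZeroDivisors
  have hfS : ι (X 0 ^ 2 * X 1 + X 1 ^ 2 * X 2 + X 2 ^ 2 * X 0) ∈ nonZeroDivisors S := by
    refine mem_nonZeroDivisors_of_ne_zero fun h => f_ne_zero k (hinj ?_)
    rw [h, map_zero]
  haveI : IsNoetherianRing S := IsLocalization.isNoetherianRing (originIdeal k 3).primeCompl S inferInstance
  -- the Koszul factorisation over `S`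
  have hΦΨ : (!![ι b, ι q₁; -ι a, ι q₂] : Matrix (Fin 2) (Fin 2) S) * !![ι q₂, -ι q₁; ι a, ι b] =
      ι (X 0 ^ 2 * X 1 + X 1 ^ 2 * X 2 + X 2 ^ 2 * X 0) • (1 : Matrix (Fin 2) (Fin 2) S) := by
    rw [koszulMF_mul, ← hf, map_add, map_mul, map_mul]
  have hΨΦ : (!![ι q₂, -ι q₁; ι a, ι b] : Matrix (Fin 2) (Fin 2) S) * !![ι b, ι q₁; -ι a, ι q₂] =
      ι (X 0 ^ 2 * X 1 + X 1 ^ 2 * X 2 + X 2 ^ 2 * X 0) • (1 : Matrix (Fin 2) (Fin 2) S) := by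
    rw [koszulMF_mul', ← hf, map_add, map_mul, map_mul]
  have hdet : (!![ι b, ι q₁; -ι a, ι q₂] : Matrix (Fin 2) (Fin 2) S).det ∈ nonZeroDivisors S := by
    rw [koszulMF_det, ← map_mul, ← map_mul, ← map_add, hf]
    exact hfS
  -- the test values
  have hT2 : ∀ {p : MvPolynomial (Fin 3) k}, MvPolynomial.aeval w p ∈ Ideal.span ({Polynomial.X ^ 2} : Set (Polynomial k)) →
      τ (ι p) ∈ Ideal.span ({PowerSeries.X ^ 2} : Set (PowerSeries k)) := fun hp => by
    rw [hτ, KC3Upper.coe_mem_span_X_pow_iff]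
    exact hp
  have ha' : τ (ι a) = 0 := by rw [hτ, ha, Polynomial.coe_zero]
  have hq₂' : τ (ι q₂) = 0 := by rw [hτ, hq₂, Polynomial.coe_zero]
  have hc' : τ (ι c) ∉ Ideal.span ({PowerSeries.X ^ 2} : Set (PowerSeries k)) := by
    rw [hτ, KC3Upper.coe_mem_span_X_pow_iff]
    exact hc
  exact LostCertificate.not_mem_cohomologyAnnihilatorOfDegree_of_not_exists_certificate
    (ι (X 0 ^ 2 * X 1 + X 1 ^ 2 * X 2 + X 2 ^ 2 * X 0)) hfS !![ι b, ι q₁; -ι a, ι q₂] !![ι q₂, -ι q₁; ι a, ι b]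
    hΦΨ hΨΦ hdet (ι c)
    (fun ⟨_, _, h⟩ => hc' (map_mem_of_koszul_certificate τ _ ha' hq₂' (hT2 hb) (hT2 hq₁) h)) m

/-! ## §4 The three rulings: the ceiling `ca ⊆ 𝔪²` -/

/-- The coefficient of `Tʲ` in `c(0,…,T,…,0)` (`T` in slot `i`) is the coefficient of `Xᵢʲ` in `c`. [folklore] -/
theorem coeff_aeval_single {n : ℕ} (i : Fin n) (c : MvPolynomial (Fin n) k) (j : ℕ) :
    (MvPolynomial.aeval (R := k) (Pi.single i (Polynomial.X : Polynomial k)) c).coeff j =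
      coeff (Finsupp.single i j) c := by
  classical
  induction c using MvPolynomial.induction_on' with
  | monomial m r =>
    rw [aeval_monomial, coeff_monomial, Polynomial.algebraMap_eq]
    by_cases hm : m = Finsupp.single i (m i)
    · -- a pure power of `X i`
      have hprod : (m.prod fun l e => (Pi.single i (Polynomial.X : Polynomial k) : Fin n → Polynomial k) l ^ e) =
          Polynomial.X ^ (m i) := by
        rw [hm, Finsupp.prod_single_index (by simp)]
        simp
      rw [hprod, Polynomial.coeff_C_mul_X_pow]
      by_cases hj : j = m i
      · subst hj
        rw [if_pos rfl, if_pos hm]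
      · rw [if_neg hj, if_neg]
        intro h
        exact hj (by rw [h]; simp)
    · -- some other variable occurs: the product vanishes
      have hl : ∃ l, l ≠ i ∧ m l ≠ 0 := by
        by_contra hcon
        push Not at hcon
        apply hm
        ext l
        by_cases hli : l = i
        · subst hli; rw [Finsupp.single_eq_same]
        · rw [Finsupp.single_apply, if_neg (Ne.symm hli), hcon l hli]
      obtain ⟨l, hli, hl0⟩ := hl
      have hprod : (m.prod fun l e => (Pi.single i (Polynomial.X : Polynomial k) : Fin n → Polynomial k) l ^ e) = 0 := by
        rw [Finsupp.prod, Finset.prod_eq_zero (i := l) (Finsupp.mem_support_iff.mpr hl0)]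
        rw [Pi.single_eq_of_ne hli, zero_pow hl0]
      rw [hprod, mul_zero, Polynomial.coeff_zero, if_neg]
      intro h
      apply hl0
      rw [h, Finsupp.single_apply, if_neg (Ne.symm hli)]
  | add p q hp hq => rw [map_add, Polynomial.coeff_add, coeff_add, hp, hq]

/-- A polynomial `q ∈ k[T]` lies in `(T²)` iff its coefficients of `1` and `T` vanish. [folklore] -/
theorem mem_span_X_sq_iff (q : Polynomial k) :
    q ∈ Ideal.span ({Polynomial.X ^ 2} : Set (Polynomial k)) ↔ q.coeff 0 = 0 ∧ q.coeff 1 = 0 := by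
  rw [Ideal.mem_span_singleton, Polynomial.X_pow_dvd_iff]
  constructor
  · intro h; exact ⟨h 0 (by norm_num), h 1 (by norm_num)⟩
  · rintro ⟨h0, h1⟩ d hd
    interval_cases d
    · exact h0
    · exact h1

/-- **THE CEILING, coefficient form (OURS · W4.4 (R-QH)).** If the class of a polynomial `c` lies in some
`caⁿ(k[x,y,z]_Q ⧸ (x²y + y²z + z²x))` (`Q = originIdeal k 3`) then `c(0) = 0` and the coefficients of `x, y, z` in `c` vanish:
the rulings `f = y(x² + yz) + z(zx)`, `z(y² + zx) + x(xy)`, `x(z² + xy) + y(yz)` tested along `(T,0,0)`, `(0,T,0)`, `(0,0,T)` each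
return `c ∈ (T²)`. Every field `k`. [OURS · W4.4 kill test] -/
theorem coeff_eq_zero_of_mk_algebraMap_mem_cohomologyAnnihilatorOfDegree (Q : Ideal (MvPolynomial (Fin 3) k))
    [Q.IsPrime] (hQ : Q = originIdeal k 3) (c : MvPolynomial (Fin 3) k) {n : ℕ}
    (h : Ideal.Quotient.mk (Ideal.span {algebraMap (MvPolynomial (Fin 3) k) (Localization.AtPrime Q)
        (X 0 ^ 2 * X 1 + X 1 ^ 2 * X 2 + X 2 ^ 2 * X 0)})
      (algebraMap (MvPolynomial (Fin 3) k) (Localization.AtPrime Q) c) ∈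
      cohomologyAnnihilatorOfDegree (Localization.AtPrime Q ⧸
        Ideal.span {algebraMap (MvPolynomial (Fin 3) k) (Localization.AtPrime Q)
          (X 0 ^ 2 * X 1 + X 1 ^ 2 * X 2 + X 2 ^ 2 * X 0)}) n) :
    constantCoeff c = 0 ∧ ∀ i : Fin 3, coeff (Finsupp.single i 1) c = 0 := by
  -- each ruling test returns `c(0,…,T,…,0) ∈ (T²)`
  have key : ∀ i : Fin 3, MvPolynomial.aeval (R := k) (Pi.single i (Polynomial.X : Polynomial k)) c ∈
      Ideal.span ({Polynomial.X ^ 2} : Set (Polynomial k)) := by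
    intro i
    by_contra hc
    fin_cases i
    · -- ruling `y = z = 0`: `f = y·(x² + yz) + z·(zx)`
      exact mk_algebraMap_not_mem_cohomologyAnnihilatorOfDegree_of_test k Q hQ
        (a := X 1) (b := X 2) (q₁ := X 0 ^ 2 + X 1 * X 2) (q₂ := X 2 * X 0) (by ring)
        (Pi.single 0 Polynomial.X) (fun l => by fin_cases l <;> simp) (by simp) (by simp) (by simp)
        (by simp) c hc n h
    · -- ruling `z = x = 0`: `f = z·(y² + zx) + x·(xy)`
      exact mk_algebraMap_not_mem_cohomologyAnnihilatorOfDegree_of_test k Q hQ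
        (a := X 2) (b := X 0) (q₁ := X 1 ^ 2 + X 2 * X 0) (q₂ := X 0 * X 1) (by ring)
        (Pi.single 1 Polynomial.X) (fun l => by fin_cases l <;> simp) (by simp) (by simp) (by simp)
        (by simp) c hc n h
    · -- ruling `x = y = 0`: `f = x·(z² + xy) + y·(yz)`
      exact mk_algebraMap_not_mem_cohomologyAnnihilatorOfDegree_of_test k Q hQ
        (a := X 0) (b := X 1) (q₁ := X 2 ^ 2 + X 0 * X 1) (q₂ := X 1 * X 2) (by ring)
        (Pi.single 2 Polynomial.X) (fun l => by fin_cases l <;> simp) (by simp) (by simp) (by simp)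
        (by simp) c hc n h
  have key' : ∀ i : Fin 3, coeff (Finsupp.single i 0) c = 0 ∧ coeff (Finsupp.single i 1) c = 0 := fun i => by
    have hi := (mem_span_X_sq_iff k _).mp (key i)
    rw [coeff_aeval_single, coeff_aeval_single] at hi
    exact hi
  refine ⟨?_, fun i => (key' i).2⟩
  have h0 := (key' 0).1
  rwa [Finsupp.single_zero, ← constantCoeff_eq] at h0

/-- A monomial exponent of degree `< 2` is `0` or a single variable. [folklore] -/
theorem eq_zero_or_eq_single_of_degree_lt_two {n : ℕ} (m : Fin n →₀ ℕ) (hm : m.degree < 2) :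
    m = 0 ∨ ∃ i, m = Finsupp.single i 1 := by
  classical
  by_cases h0 : m = 0
  · exact Or.inl h0
  right
  obtain ⟨i, hi⟩ := Finsupp.ne_iff.mp h0
  simp only [Finsupp.coe_zero, Pi.zero_apply] at hi
  have hle : m i ≤ m.degree := Finsupp.le_degree i m
  refine ⟨i, ?_⟩
  ext l
  by_cases hli : l = i
  · subst hli
    rw [Finsupp.single_eq_same]
    omega
  · rw [Finsupp.single_apply, if_neg (Ne.symm hli)]
    -- `m i + m l ≤ degree m < 2` and `m i ≥ 1`
    have hsum : m i + m l ≤ m.degree := by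
      rw [Finsupp.degree_eq_sum]
      rw [← Finset.sum_pair (f := fun j => m j) (Ne.symm hli)]
      exact Finset.sum_le_sum_of_subset_of_nonneg (Finset.subset_univ _) fun _ _ _ => Nat.zero_le _
    omega

/-- **THE CEILING `ca ⊆ 𝔪²` (OURS · W4.4 (R-QH)).** If the class of a polynomial `c` lies in some
`caⁿ(k[x,y,z]_Q ⧸ (x²y + y²z + z²x))` (`Q = originIdeal k 3`) then **`c ∈ 𝔪² = (x,y,z)²`** (`idealOfVars`). [OURS · W4.4 kill test] -/
theorem mem_sq_of_mk_algebraMap_mem_cohomologyAnnihilatorOfDegree (Q : Ideal (MvPolynomial (Fin 3) k)) [Q.IsPrime]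
    (hQ : Q = originIdeal k 3) (c : MvPolynomial (Fin 3) k) {n : ℕ}
    (h : Ideal.Quotient.mk (Ideal.span {algebraMap (MvPolynomial (Fin 3) k) (Localization.AtPrime Q)
        (X 0 ^ 2 * X 1 + X 1 ^ 2 * X 2 + X 2 ^ 2 * X 0)})
      (algebraMap (MvPolynomial (Fin 3) k) (Localization.AtPrime Q) c) ∈
      cohomologyAnnihilatorOfDegree (Localization.AtPrime Q ⧸
        Ideal.span {algebraMap (MvPolynomial (Fin 3) k) (Localization.AtPrime Q)
          (X 0 ^ 2 * X 1 + X 1 ^ 2 * X 2 + X 2 ^ 2 * X 0)}) n) :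
    c ∈ idealOfVars (Fin 3) k ^ 2 := by
  obtain ⟨h0, h1⟩ := coeff_eq_zero_of_mk_algebraMap_mem_cohomologyAnnihilatorOfDegree k Q hQ c h
  rw [mem_pow_idealOfVars_iff']
  intro m hm
  rcases eq_zero_or_eq_single_of_degree_lt_two m hm with rfl | ⟨i, rfl⟩
  · rwa [← constantCoeff_eq]
  · exact h1 i

/-! ## §5 The floor: the Jacobian quadrics lie in `ca³` -/

/-- **THE FLOOR (OURS · W4.4 (R-QH)).** `(∂f/∂Xᵢ)‾ ∈ ca³(k[x,y,z]_Q ⧸ (f))`, `f = x²y + y²z + z²x`, `Q = originIdeal k 3`: the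
affine Jacobian criterion (res-D-pv-058) pushed to the localisation by Iyengar–Takahashi's Lemma 2.10 (1) and moved to
`k[x,y,z]_Q ⧸ (f)` along `Ideal.quotEquivOfEq`. [cite: IyengarTakahashi2014, Lemma 2.10 (1)] -/
theorem mk_algebraMap_pderiv_mem_cohomologyAnnihilatorOfDegree_three (Q : Ideal (MvPolynomial (Fin 3) k)) [Q.IsPrime]
    (hQ : Q = originIdeal k 3) (i : Fin 3) :
    Ideal.Quotient.mk (Ideal.span {algebraMap (MvPolynomial (Fin 3) k) (Localization.AtPrime Q)
        (X 0 ^ 2 * X 1 + X 1 ^ 2 * X 2 + X 2 ^ 2 * X 0)})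
      (algebraMap (MvPolynomial (Fin 3) k) (Localization.AtPrime Q)
        (pderiv i (X 0 ^ 2 * X 1 + X 1 ^ 2 * X 2 + X 2 ^ 2 * X 0))) ∈
      cohomologyAnnihilatorOfDegree (Localization.AtPrime Q ⧸
        Ideal.span {algebraMap (MvPolynomial (Fin 3) k) (Localization.AtPrime Q)
          (X 0 ^ 2 * X 1 + X 1 ^ 2 * X 2 + X 2 ^ 2 * X 0)}) 3 := by
  subst hQ
  set f : MvPolynomial (Fin 3) k := X 0 ^ 2 * X 1 + X 1 ^ 2 * X 2 + X 2 ^ 2 * X 0 with hf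
  set S := Localization.AtPrime (originIdeal k 3)
  have haff := PersistenceJacobianKept.pderiv_mem_cohomologyAnnihilatorOfDegree (d := 2) f (f_ne_zero k) i
  have hloc := map_cohomologyAnnihilatorOfDegree_le_of_isLocalization
    (Algebra.algebraMapSubmonoid (MvPolynomial (Fin 3) k ⧸ Ideal.span {f}) (originIdeal k 3).primeCompl)
    (S ⧸ (Ideal.span {f}).map (algebraMap (MvPolynomial (Fin 3) k) S)) 3
    (Ideal.mem_map_of_mem _ haff)
  rw [Ideal.Quotient.algebraMap_quotient_map_quotient] at hloc
  have hmap : (Ideal.span {f}).map (algebraMap (MvPolynomial (Fin 3) k) S) =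
      Ideal.span {algebraMap (MvPolynomial (Fin 3) k) S f} := by
    rw [Ideal.map_span, Set.image_singleton]
  have h2 := ringEquiv_apply_mem_cohomologyAnnihilatorOfDegree
    (R := S ⧸ (Ideal.span {f}).map (algebraMap (MvPolynomial (Fin 3) k) S))
    (S := S ⧸ Ideal.span {algebraMap (MvPolynomial (Fin 3) k) S f}) (Ideal.quotEquivOfEq hmap) hloc
  rwa [Ideal.quotEquivOfEq_mk] at h2

/-- The three Jacobian quadrics: `∂f/∂x = 2xy + z²`, `∂f/∂y = x² + 2yz`, `∂f/∂z = y² + 2zx`. [folklore] -/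
theorem pderiv_f_eq (i : Fin 3) :
    pderiv i (X 0 ^ 2 * X 1 + X 1 ^ 2 * X 2 + X 2 ^ 2 * X 0 : MvPolynomial (Fin 3) k) =
      ![2 * X 0 * X 1 + X 2 ^ 2, X 0 ^ 2 + 2 * X 1 * X 2, X 1 ^ 2 + 2 * X 2 * X 0] i := by
  fin_cases i <;> simp [pderiv_X] <;> ring

/-- **The floor, quadric form (OURS · W4.4 (R-QH)).** The class of `x² + 2yz` lies in `ca³(k[x,y,z]_Q ⧸ (f))`, and
likewise `y² + 2zx`, `z² + 2xy` — in the cyclic normal form `Xᵢ² + 2 Xᵢ₊₁ Xᵢ₊₂`. [OURS · W4.4 kill test] -/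
theorem mk_algebraMap_quadric_mem_cohomologyAnnihilatorOfDegree_three (Q : Ideal (MvPolynomial (Fin 3) k)) [Q.IsPrime]
    (hQ : Q = originIdeal k 3) (i : Fin 3) :
    Ideal.Quotient.mk (Ideal.span {algebraMap (MvPolynomial (Fin 3) k) (Localization.AtPrime Q)
        (X 0 ^ 2 * X 1 + X 1 ^ 2 * X 2 + X 2 ^ 2 * X 0)})
      (algebraMap (MvPolynomial (Fin 3) k) (Localization.AtPrime Q)
        (![2 * X 0 * X 1 + X 2 ^ 2, X 0 ^ 2 + 2 * X 1 * X 2, X 1 ^ 2 + 2 * X 2 * X 0] i)) ∈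
      cohomologyAnnihilatorOfDegree (Localization.AtPrime Q ⧸
        Ideal.span {algebraMap (MvPolynomial (Fin 3) k) (Localization.AtPrime Q)
          (X 0 ^ 2 * X 1 + X 1 ^ 2 * X 2 + X 2 ^ 2 * X 0)}) 3 := by
  rw [← pderiv_f_eq]
  exact mk_algebraMap_pderiv_mem_cohomologyAnnihilatorOfDegree_three k Q hQ i

end Local

end Summit.ResolutionOfSingularities.ResolutionOfSingularities.Theorems.SurfaceTermination.CubicCone

end
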